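import Summits.SmoothPoincare4.SmoothPoincare4.Theorems.SullivanDualWitnessChargeReductionV8

/-!
# The glue item `WitnessChargeOfPencilFacts` (stmt-SmoothPoincare4-16810) — proof

Route `SullivanDual`, route-choice repair of 2026-08-17: the promoted crux `PencilLocalFamily`
(stmt-SmoothPoincare4-16772) and the listed Literature debt `LimitOfEmbeddedPlanes`
(stmt-SmoothPoincare4-16809) imply the crux `WitnessCharge` (stmt-SmoothPoincare4-7824). This is the
outcome of line `Sketch` of `WitnessCharge` (idea `pencil-incompleteness`; leads 0, c1–c6; ≈ 90 files
`Theorems/SullivanDualWitnessCharge*.lean`): the accepted conditional theorem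
`WitnessCharge.PencilIncompleteness.WitnessCharge_of_facts_homotopySphere :
jPlanePencil_localFamily_homotopySphere → jHolomorphicLimitOfEmbedded_isEmbedded → WitnessCharge`
(`Theorems/SullivanDualWitnessChargeReductionV8.lean`), whose two antecedents are `Iff.rfl`-equal to
the route decls `PencilLocalFamily` and `LimitOfEmbeddedPlanes`.
-/

noncomputable section

-- the registered namespace `Summit.SmoothPoincare4.SmoothPoincare4.Theorems` repeats a component
set_option linter.dupNamespace false

namespace Summit.SmoothPoincare4.SmoothPoincare4.Theorems

/-- **Item `WitnessChargeOfPencilFacts` (stmt-SmoothPoincare4-16810).**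
`PencilLocalFamily → LimitOfEmbeddedPlanes → WitnessCharge`: the two hypotheses are definitionally
the Literature named facts `jPlanePencil_localFamily_homotopySphere` (Wendl LNM 2216 Prop. 2.53,
m = 1) and `jHolomorphicLimitOfEmbedded_isEmbedded` (McDuff 1991 §4), and the conclusion is the
landed reduction `WitnessCharge_of_facts_homotopySphere` of line `Sketch`. -/
theorem witnessChargeOfPencilFacts_proof : Theses.SullivanDual.WitnessChargeOfPencilFacts := by
  unfold Theses.SullivanDual.WitnessChargeOfPencilFacts
  intro hP hL
  exact WitnessCharge.PencilIncompleteness.WitnessCharge_of_facts_homotopySphere hP hL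

end Summit.SmoothPoincare4.SmoothPoincare4.Theorems
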